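import Summits.NavierStokesRegularity.NavierStokesRegularity.Theorems.ExtremiserTransienceNearExtremalTransienceExtremiserLiouvilleConstantSpeedResidue
import Summits.NavierStokesRegularity.NavierStokesRegularity.Theorems.ExtremiserTransienceNearExtremalTransienceExtremiserLiouvilleConstantSpeedKKT
import HarnessLib

/-!
# Crux `ExtremiserTransience.NearExtremalTransience` (stmt-NavierStokesRegularity-21883), line `extremiser_liouville`,
# stub K1b — THE ¬ ∃ (w : EuclideanSpace ℝ (Fin 3) → EuclideanSpace ℝ (Fin 3)) (c : EuclideanSpace ℝ (Fin 3)) (M : ℝ), AnalyticOnNhd ℝ w Set.univ ∧ ContDiff ℝ (⊤ : ℕ∞) w ∧ Literature.Analysis.FluidPDE.VectorCalculus.IsDivFree w ∧ (∃ B : ℝ, ∀ x, ‖fderiv ℝ w x‖ ≤ B) ∧ (∫⁻ x, ‖iteratedFDeriv ℝ 1 w x‖ₑ ^ 2 < ⊤) ∧ (∫⁻ x, ‖iteratedFDeriv ℝ 2 w x‖ₑ ^ 2 < ⊤) ∧ 0 < M ∧ (∀ x, ‖w x‖ = M) ∧ ‖c‖ = M ∧ Filter.Tendsto (fun x => w x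 - c) (Filter.cocompact (EuclideanSpace ℝ (Fin 3))) (nhds 0) ∧ MeasureTheory.MemLp (fun x => w x - c) 6 MeasureTheory.volume ∧ (∀ x, ⟪w x - c, c⟫_ℝ = -(‖w x - c‖ ^ 2 / 2)) ∧ (∃ x, ⟪w x, c⟫_ℝ ≤ 0) ∧ ¬ Filter.Tendsto (fun R : ℝ => R⁻¹ * ∫ x in {x : EuclideanSpace ℝ (Fin 3) | R ≤ ‖x‖ ∧ ‖x‖ ≤ 2 * R}, ‖w x - c‖) Filter.atTop (nhds 0) ∧ 0 < M * Real.sqrt (∫ x, ‖Literature.Analysis.FluidPDE.curl w x‖ ^ 2) * Real.sqrt (∫ x, Literature.Analysis.FluidPDE.frobeniusNormSq (fderiv ℝ (Literature.Analysis.FluidPDE.curl w) x)) ∧ (sInf {κ : ℝ | (∀ (v : EuclideanSpace ℝ (Fin 3) → EuclideanSpace ℝ (Fin 3)) (M B : ℝ), ContDiff ℝ (⊤ : ℕ∞) v → Literature.Analysis.FluidPDE.VectorCalculus.IsDivFree v → (∀ x, ‖v x‖ ≤ M) → (∀ x, ‖fderiv ℝ v x‖ ≤ B) → (∫⁻ x,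 ‖iteratedFDeriv ℝ 0 v x‖ₑ ^ 2 < ⊤) → (∫⁻ x, ‖iteratedFDeriv ℝ 1 v x‖ₑ ^ 2 < ⊤) → (∫⁻ x, ‖iteratedFDeriv ℝ 2 v x‖ₑ ^ 2 < ⊤) → |∫ x, ⟪Literature.Analysis.FluidPDE.curl v x, fderiv ℝ v x (Literature.Analysis.FluidPDE.curl v x)⟫_ℝ| ≤ κ * M * Real.sqrt (∫ x, ‖Literature.Analysis.FluidPDE.curl v x‖ ^ 2) * Real.sqrt (∫ x, Literature.Analysis.FluidPDE.frobeniusNormSq (fderiv ℝ (Literature.Analysis.FluidPDE.curl v) x)))}) * M * Real.sqrt (∫ x, ‖Literature.Analysis.FluidPDE.curl w x‖ ^ 2) * Real.sqrt (∫ x, Literature.Analysis.FluidPDE.frobeniusNormSq (fderiv ℝ (Literature.Analysis.FluidPDE.curl w) x)) = |∫ x, ⟪Literature.Analysis.FluidPDE.curl w x, fderiv ℝ w x (Literature.Analysis.FluidPDE.curl w x)⟫_ℝ| ∧ (∀ (φ : EuclideanSpace ℝ (Fin 3) → EuclideanSpace ℝ (Fin 3)) (s : ℝ), ContDiff ℝ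 (⊤ : ℕ∞) φ → HasCompactSupport φ → Literature.Analysis.FluidPDE.VectorCalculus.IsDivFree φ → (∀ x, ⟪w x, φ x⟫_ℝ ≤ s) → (∫ x, ⟪Literature.Analysis.FluidPDE.curl w x, fderiv ℝ w x (Literature.Analysis.FluidPDE.curl w x)⟫_ℝ) * (∫ x, (⟪Literature.Analysis.FluidPDE.curl φ x, fderiv ℝ w x (Literature.Analysis.FluidPDE.curl w x)⟫_ℝ + ⟪Literature.Analysis.FluidPDE.curl w x, fderiv ℝ φ x (Literature.Analysis.FluidPDE.curl w x)⟫_ℝ + ⟪Literature.Analysis.FluidPDE.curl w x, fderiv ℝ w x (Literature.Analysis.FluidPDE.curl φ x)⟫_ℝ)) ≤ (sInf {κ : ℝ | (∀ (v : EuclideanSpace ℝ (Fin 3) → EuclideanSpace ℝ (Fin 3)) (M B : ℝ), ContDiff ℝ (⊤ : ℕ∞) v → Literature.Analysis.FluidPDE.VectorCalculus.IsDivFree v → (∀ x, ‖v x‖ ≤ M) → (∀ x, ‖fderiv ℝ v x‖ ≤ B) → (∫⁻ x, ‖iteratedFDeriv ℝ 0 v x‖ₑ ^ 2 < ⊤)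 → (∫⁻ x, ‖iteratedFDeriv ℝ 1 v x‖ₑ ^ 2 < ⊤) → (∫⁻ x, ‖iteratedFDeriv ℝ 2 v x‖ₑ ^ 2 < ⊤) → |∫ x, ⟪Literature.Analysis.FluidPDE.curl v x, fderiv ℝ v x (Literature.Analysis.FluidPDE.curl v x)⟫_ℝ| ≤ κ * M * Real.sqrt (∫ x, ‖Literature.Analysis.FluidPDE.curl v x‖ ^ 2) * Real.sqrt (∫ x, Literature.Analysis.FluidPDE.frobeniusNormSq (fderiv ℝ (Literature.Analysis.FluidPDE.curl v) x)))}) ^ 2 * M ^ 2 * (s / M ^ 2 * (∫ x, ‖Literature.Analysis.FluidPDE.curl w x‖ ^ 2) * (∫ x, Literature.Analysis.FluidPDE.frobeniusNormSq (fderiv ℝ (Literature.Analysis.FluidPDE.curl w) x)) + (∫ x, Literature.Analysis.FluidPDE.frobeniusNormSq (fderiv ℝ (Literature.Analysis.FluidPDE.curl w) x)) * (∫ x, ⟪Literature.Analysis.FluidPDE.curl w x, Literature.Analysis.FluidPDE.curl φ x⟫_ℝ) + (∫ x, ‖Literature.Analysis.FluidPDE.curl w x‖ ^ 2) * (∫ x,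 ∑ i, ⟪fderiv ℝ (Literature.Analysis.FluidPDE.curl w) x (EuclideanSpace.basisFun (Fin 3) ℝ i), fderiv ℝ (Literature.Analysis.FluidPDE.curl φ) x (EuclideanSpace.basisFun (Fin 3) ℝ i)⟫_ℝ))) OBJECT WITH ALL ITS PROVEN PROPERTIES (dossier for refuters / planners)

`--supports stmt-NavierStokesRegularity-21883` (helper).  Author: prover seat `ns-el-k1b` (g2).

`stub_noAnalyticExtremal_of_noDossierObject`: K1b (registered conclusion VERBATIM) follows from the non-existence of a
triple `(w, c, M)` with: `w` analytic, smooth, divergence free, `‖Dw‖` bounded, `Dw, D²w ∈ L²`; `0 < M`, `‖w‖ ≡ M`,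
`‖c‖ = M`, `w − c → 0` at infinity, `w − c ∈ L⁶`, the pointwise identity `⟪w − c, c⟫ = −‖w − c‖²/2`; a REVERSAL point
`⟪w x, c⟫ ≤ 0`; SLOW decay (`R⁻¹∫_{R ≤ ‖x‖ ≤ 2R} ‖w − c‖ ↛ 0`); `0 < M√Z√W`; exact extremality `κ⋆M√Z√W = |S(w)|`; and
the KKT inequality `S·J₁(φ) ≤ κ⋆²M²((s/M²)ZW + W a₁(φ) + Z c₁(φ))` for EVERY smooth compactly supported divergence-free
`φ` and every `s ≥ sup ⟪w, φ⟫`.  (Strengthens `stub_noAnalyticExtremal_of_noResidue` by `L⁶`, the identity, and KKT.)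

WHAT THIS IS NOT: K1b is NOT proved; nothing here proves NS regularity. [folklore]
-/

noncomputable section

open Set Filter Topology MeasureTheory Metric Function
open scoped ENNReal NNReal Topology InnerProductSpace RealInnerProductSpace ContDiff
open Literature.Analysis.FluidPDE Literature.Analysis

namespace Summit.NavierStokesRegularity.NavierStokesRegularity.Theorems

-- the problem directory repeats the summit name (`NavierStokesRegularity/NavierStokesRegularity`)
set_option linter.dupNamespace false

namespace ExtremiserLiouville

open DepletionLadder.KStar

/-- **K1b ⟸ no dossier object** (all proven necessary properties of a violator bundled). [folklore] -/
theorem stub_noAnalyticExtremal_of_noDossierObject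
    (hres : ¬ ∃ (w : EuclideanSpace ℝ (Fin 3) → EuclideanSpace ℝ (Fin 3)) (c : EuclideanSpace ℝ (Fin 3)) (M : ℝ), AnalyticOnNhd ℝ w Set.univ ∧ ContDiff ℝ (⊤ : ℕ∞) w ∧ Literature.Analysis.FluidPDE.VectorCalculus.IsDivFree w ∧ (∃ B : ℝ, ∀ x, ‖fderiv ℝ w x‖ ≤ B) ∧ (∫⁻ x, ‖iteratedFDeriv ℝ 1 w x‖ₑ ^ 2 < ⊤) ∧ (∫⁻ x, ‖iteratedFDeriv ℝ 2 w x‖ₑ ^ 2 < ⊤) ∧ 0 < M ∧ (∀ x, ‖w x‖ = M) ∧ ‖c‖ = M ∧ Filter.Tendsto (fun x => w x - c) (Filter.cocompact (EuclideanSpace ℝ (Fin 3))) (nhds 0) ∧ MeasureTheory.MemLp (fun x => w x - c) 6 MeasureTheory.volume ∧ (∀ x, ⟪w x - c, c⟫_ℝ = -(‖w x - c‖ ^ 2 / 2)) ∧ (∃ x, ⟪w x, c⟫_ℝ ≤ 0) ∧ ¬ Filter.Tendsto (fun R : ℝ => R⁻¹ * ∫ x in {x : EuclideanSpace ℝ (Fin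 3) | R ≤ ‖x‖ ∧ ‖x‖ ≤ 2 * R}, ‖w x - c‖) Filter.atTop (nhds 0) ∧ 0 < M * Real.sqrt (∫ x, ‖Literature.Analysis.FluidPDE.curl w x‖ ^ 2) * Real.sqrt (∫ x, Literature.Analysis.FluidPDE.frobeniusNormSq (fderiv ℝ (Literature.Analysis.FluidPDE.curl w) x)) ∧ (sInf {κ : ℝ | (∀ (v : EuclideanSpace ℝ (Fin 3) → EuclideanSpace ℝ (Fin 3)) (M B : ℝ), ContDiff ℝ (⊤ : ℕ∞) v → Literature.Analysis.FluidPDE.VectorCalculus.IsDivFree v → (∀ x, ‖v x‖ ≤ M) → (∀ x, ‖fderiv ℝ v x‖ ≤ B) → (∫⁻ x, ‖iteratedFDeriv ℝ 0 v x‖ₑ ^ 2 < ⊤) → (∫⁻ x, ‖iteratedFDeriv ℝ 1 v x‖ₑ ^ 2 < ⊤) → (∫⁻ x, ‖iteratedFDeriv ℝ 2 v x‖ₑ ^ 2 < ⊤) → |∫ x, ⟪Literature.Analysis.FluidPDE.curl v x, fderiv ℝ v x (Literature.Analysis.FluidPDE.curl v x)⟫_ℝ| ≤ κ * M * Real.sqrt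 (∫ x, ‖Literature.Analysis.FluidPDE.curl v x‖ ^ 2) * Real.sqrt (∫ x, Literature.Analysis.FluidPDE.frobeniusNormSq (fderiv ℝ (Literature.Analysis.FluidPDE.curl v) x)))}) * M * Real.sqrt (∫ x, ‖Literature.Analysis.FluidPDE.curl w x‖ ^ 2) * Real.sqrt (∫ x, Literature.Analysis.FluidPDE.frobeniusNormSq (fderiv ℝ (Literature.Analysis.FluidPDE.curl w) x)) = |∫ x, ⟪Literature.Analysis.FluidPDE.curl w x, fderiv ℝ w x (Literature.Analysis.FluidPDE.curl w x)⟫_ℝ| ∧ (∀ (φ : EuclideanSpace ℝ (Fin 3) → EuclideanSpace ℝ (Fin 3)) (s : ℝ), ContDiff ℝ (⊤ : ℕ∞) φ → HasCompactSupport φ → Literature.Analysis.FluidPDE.VectorCalculus.IsDivFree φ → (∀ x, ⟪w x, φ x⟫_ℝ ≤ s) → (∫ x, ⟪Literature.Analysis.FluidPDE.curl w x, fderiv ℝ w x (Literature.Analysis.FluidPDE.curl w x)⟫_ℝ) * (∫ x, (⟪Literature.Analysis.FluidPDE.curl φ x, fderiv ℝ w x (Literature.Analysis.FluidPDE.curl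 w x)⟫_ℝ + ⟪Literature.Analysis.FluidPDE.curl w x, fderiv ℝ φ x (Literature.Analysis.FluidPDE.curl w x)⟫_ℝ + ⟪Literature.Analysis.FluidPDE.curl w x, fderiv ℝ w x (Literature.Analysis.FluidPDE.curl φ x)⟫_ℝ)) ≤ (sInf {κ : ℝ | (∀ (v : EuclideanSpace ℝ (Fin 3) → EuclideanSpace ℝ (Fin 3)) (M B : ℝ), ContDiff ℝ (⊤ : ℕ∞) v → Literature.Analysis.FluidPDE.VectorCalculus.IsDivFree v → (∀ x, ‖v x‖ ≤ M) → (∀ x, ‖fderiv ℝ v x‖ ≤ B) → (∫⁻ x, ‖iteratedFDeriv ℝ 0 v x‖ₑ ^ 2 < ⊤) → (∫⁻ x, ‖iteratedFDeriv ℝ 1 v x‖ₑ ^ 2 < ⊤) → (∫⁻ x, ‖iteratedFDeriv ℝ 2 v x‖ₑ ^ 2 < ⊤) → |∫ x, ⟪Literature.Analysis.FluidPDE.curl v x, fderiv ℝ v x (Literature.Analysis.FluidPDE.curl v x)⟫_ℝ| ≤ κ * M * Real.sqrt (∫ x, ‖Literature.Analysis.FluidPDE.curl v x‖ ^ 2)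 * Real.sqrt (∫ x, Literature.Analysis.FluidPDE.frobeniusNormSq (fderiv ℝ (Literature.Analysis.FluidPDE.curl v) x)))}) ^ 2 * M ^ 2 * (s / M ^ 2 * (∫ x, ‖Literature.Analysis.FluidPDE.curl w x‖ ^ 2) * (∫ x, Literature.Analysis.FluidPDE.frobeniusNormSq (fderiv ℝ (Literature.Analysis.FluidPDE.curl w) x)) + (∫ x, Literature.Analysis.FluidPDE.frobeniusNormSq (fderiv ℝ (Literature.Analysis.FluidPDE.curl w) x)) * (∫ x, ⟪Literature.Analysis.FluidPDE.curl w x, Literature.Analysis.FluidPDE.curl φ x⟫_ℝ) + (∫ x, ‖Literature.Analysis.FluidPDE.curl w x‖ ^ 2) * (∫ x, ∑ i, ⟪fderiv ℝ (Literature.Analysis.FluidPDE.curl w) x (EuclideanSpace.basisFun (Fin 3) ℝ i), fderiv ℝ (Literature.Analysis.FluidPDE.curl φ) x (EuclideanSpace.basisFun (Fin 3) ℝ i)⟫_ℝ)))) :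
    ¬ ∃ (w : EuclideanSpace ℝ (Fin 3) → EuclideanSpace ℝ (Fin 3)), AnalyticOnNhd ℝ w Set.univ ∧ (ContDiff ℝ (⊤ : ℕ∞) w ∧ Literature.Analysis.FluidPDE.VectorCalculus.IsDivFree w ∧ (∃ B : ℝ, ∀ x, ‖fderiv ℝ w x‖ ≤ B) ∧ (∫⁻ x, ‖iteratedFDeriv ℝ 1 w x‖ₑ ^ 2 < ⊤) ∧ (∫⁻ x, ‖iteratedFDeriv ℝ 2 w x‖ₑ ^ 2 < ⊤) ∧ ∃ M : ℝ, (∀ x, ‖w x‖ ≤ M) ∧ 0 < M * Real.sqrt (∫ x, ‖Literature.Analysis.FluidPDE.curl w x‖ ^ 2) * Real.sqrt (∫ x, Literature.Analysis.FluidPDE.frobeniusNormSq (fderiv ℝ (Literature.Analysis.FluidPDE.curl w) x)) ∧ (sInf {κ : ℝ | (∀ (v : EuclideanSpace ℝ (Fin 3) → EuclideanSpace ℝ (Fin 3)) (M B : ℝ), ContDiff ℝ (⊤ : ℕ∞) v → Literature.Analysis.FluidPDE.VectorCalculus.IsDivFree v → (∀ x, ‖v x‖ ≤ M) → (∀ x,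 ‖fderiv ℝ v x‖ ≤ B) → (∫⁻ x, ‖iteratedFDeriv ℝ 0 v x‖ₑ ^ 2 < ⊤) → (∫⁻ x, ‖iteratedFDeriv ℝ 1 v x‖ₑ ^ 2 < ⊤) → (∫⁻ x, ‖iteratedFDeriv ℝ 2 v x‖ₑ ^ 2 < ⊤) → |∫ x, ⟪Literature.Analysis.FluidPDE.curl v x, fderiv ℝ v x (Literature.Analysis.FluidPDE.curl v x)⟫_ℝ| ≤ κ * M * Real.sqrt (∫ x, ‖Literature.Analysis.FluidPDE.curl v x‖ ^ 2) * Real.sqrt (∫ x, Literature.Analysis.FluidPDE.frobeniusNormSq (fderiv ℝ (Literature.Analysis.FluidPDE.curl v) x)))}) * M * Real.sqrt (∫ x, ‖Literature.Analysis.FluidPDE.curl w x‖ ^ 2) * Real.sqrt (∫ x, Literature.Analysis.FluidPDE.frobeniusNormSq (fderiv ℝ (Literature.Analysis.FluidPDE.curl w) x)) ≤ |∫ x, ⟪Literature.Analysis.FluidPDE.curl w x, fderiv ℝ w x (Literature.Analysis.FluidPDE.curl w x)⟫_ℝ|) := by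
  refine stub_noAnalyticExtremal_iff_noConstantSpeedExtremiser.2 ?_
  rintro ⟨w, han, hcd, hdiv, ⟨B, hB⟩, h1, h2, M, hM, hpos, hge⟩
  have hle := extendedSharp w M B hcd hdiv (fun x => (hM x).le) hB h1 h2
  have heq := le_antisymm hge hle
  have hM0 : 0 ≤ M := (norm_nonneg _).trans (hM 0).le
  have hMpos : 0 < M := by
    rcases hM0.eq_or_lt with h | h
    · rw [← h, zero_mul, zero_mul] at hpos; exact absurd hpos (lt_irrefl _)
    · exact h
  -- the far field with `L⁶` and the identity
  have hw1 : ContDiff ℝ 1 w := contDiff_infty.1 hcd 1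
  have hD : ∫⁻ x, ‖fderiv ℝ w x‖ₑ ^ 2 < ⊤ := by
    refine lt_of_le_of_lt (le_of_eq (lintegral_congr fun x => ?_)) h1
    rw [(enorm_iteratedFDeriv_one_two w x).1]
  obtain ⟨c, hcM, hdec, hmem, hid⟩ := exists_farField_of_constSpeed hw1 hM hB hD
  -- the reversal point (its far-field value coincides with `c`)
  obtain ⟨c', -, hdec', x₀, hx₀⟩ :=
    exists_inner_farField_nonpos_of_constSpeed_extremal hcd hdiv hM hB h1 h2 hpos heq.symm
  have hcc : c' = c := by
    have h := hdec.sub hdec'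
    simp only [sub_sub_sub_cancel_left, sub_zero] at h
    haveI : (cocompact (EuclideanSpace ℝ (Fin 3))).NeBot := cocompact_neBot_iff.2 inferInstance
    exact (sub_eq_zero.1 (tendsto_const_nhds_iff.1 h))
  rw [hcc] at hx₀
  refine hres ⟨w, c, M, han, hcd, hdiv, ⟨B, hB⟩, h1, h2, hMpos, hM, hcM, hdec, hmem, fun x => (hid x).1, ⟨x₀, hx₀⟩,
    ?_, hpos, heq, fun φ s hφ hφc hφdiv hs => ?_⟩
  · intro hflux
    have hconst := eq_farField_of_constSpeed_of_lateralFlux hw1 hdiv hM hcM hflux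
    have hw : w = fun _ => c := funext hconst
    have hcurl : ∀ x, curl w x = 0 := fun x => by
      rw [hw, curl_eq_curlCLM, fderiv_const_apply, map_zero]
    have hZ : (∫ x, ‖curl w x‖ ^ 2) = 0 := by simp [hcurl]
    rw [hZ, Real.sqrt_zero, mul_zero, zero_mul] at hpos
    exact lt_irrefl _ hpos
  · exact ext_firstVariation_le_of_sup_inner hcd hdiv hMpos hM hB h1 h2 heq.symm hφ hφc hφdiv hs

end ExtremiserLiouville

end Summit.NavierStokesRegularity.NavierStokesRegularity.Theorems

end
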